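import Summits.HodgeConjecture.HodgeConjecture.Theorems.F0P3cStCharTSShellPatternHom      -- ★∕filed p849297 (this seat): shell pattern through `E : G →* GL₃(K)`
import Summits.HodgeConjecture.HodgeConjecture.Theorems.F0P3cStCharTSOffStratumVal       -- ★ p849250 (this seat): cubic pattern ⇒ `|c₂| < |c₁|²`
import Literature.NumberTheory.Rogawski1990.UnitaryVertexStabilizerSpanCM                -- ★ `charpoly_conj_out_eq_of_delta_ne_zero`
import Literature.NumberTheory.Rogawski1990.LocalNormFibreSurjectiveNonsplit             -- ★ `coe_localNonsplitEquiv_eq_map`, `charpoly_localNonsplitEquiv`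
import Literature.NumberTheory.Rogawski1990.LocalNormFibreNonsplit                       -- ★ `charpoly_endoEmbLocal`
import HarnessLib

/-!
# F0 · P3c · line LH6 «StCharTS» — road (D) «DEEP-FL», brick D3-iii-G «OFF-STRATUM TEST, G-SIDE, ON THE CM CARRIERS»: if a class `c` of `U(Φ₃)(L⁺_v)` is Δ‴-matched
# with `γ_H = (h₂, h₁)` and meets the deep shell `K_n (z·aᵐ) K_n`, then the `U(Φ₂)`-block satisfies `|det h₂|_w < |tr h₂|_w²` (so ★ HYP puts `γ_H` ON the stratum)

Cell `pub/hodgecm-mathlib`, crux H413 = `stmt-HodgeConjecture-24833` (`--supports` lane, helper), route HCCMUnconditional; seat LH6-p04 (g2), road (D) owner;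
status v3 `F0/P3b/LH6-p04/g2/ROAD-D.status.v3.txt` brick D3-iii (CM instantiation, `G`-side).  THEOREMS ONLY, sorry-free.  HONEST LABEL: HC_CM is proved only
modulo the 7 printed citations (2 remaining: hLiu418 = stmt-HodgeConjecture-24832, h413 = stmt-HodgeConjecture-24833) until rung 0 closes; count-neutral.

CHAIN (all ★): ★ `charpoly_conj_out_eq_of_delta_ne_zero` (`Δ‴(γ_H, out c) ≠ 0` ⇒ `charpoly(E₃(y·out c·y⁻¹)) = (charpoly ι_v(γ_H)).map eval_w`) · ★ `charpoly_endoEmbLocal`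
(`= χ_{h₂}·(X − u)`) · ★ D3-iii-hom `valuation_charpoly_coeff_of_mem_shell` at `E₃ = localNonsplitEquiv` (the conjugate lies in the shell ⇒ coefficient valuations
`(|α|^{-m}, |α|^{-m}, 1)` since `|β| = 1`, §1) · §2 the polynomial identity for the coefficients of `(X² − c₁X + c₂)(X − u)` · ★ D3-iii-val `valued_lt_sq_of_cubic_pattern`
(`|u|_w = 1`, §1).  The central element is read through a hypothesis `E₃ z = β • 1` (discharged by ★ `forall_mem_center_cmLocal_eq_scalar` at assembly).
[Rogawski1990, §4.3 p. 42; §12.7 L. 12.7.3 proof p. 195.]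

## References
* [Rogawski1990] J. D. Rogawski, *Automorphic Representations of Unitary Groups in Three Variables*, Ann. of Math. Stud. 123 (1990), §4.3 p. 42; §12.7 p. 195.
* [PlatonovRapinchuk1994] V. Platonov, A. Rapinchuk, *Algebraic Groups and Number Theory* (1994), §5.1 (the one-place model).
-/

set_option autoImplicit false
-- the mandated namespace has the single-problem summit's repeated segment (`HodgeConjecture.HodgeConjecture`)
set_option linter.dupNamespace false

noncomputable section

open Matrix Polynomial NumberField IsDedekindDomain
open scoped MatrixGroups
open Literature.NumberTheory.Rogawski1990 Literature.NumberTheory.Automorphic Literature.NumberTheory.Automorphic.UnitaryGroup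
open Literature.NumberTheory.GaloisRepresentations

namespace Summit.HodgeConjecture.HodgeConjecture.Cruxes.H413.F0P3cStCharTSOffStratumG

/-! ## §1 Unitary scalars and unitary `1 × 1` blocks have valuation one -/

section Scalar

variable {K : Type*} [Field K] {Γ₀ : Type*} [LinearOrderedCommGroupWithZero Γ₀] (v : Valuation K Γ₀) (σ : K →+* K)

/-- If `v(σ x) = v(x)` and `σ(x)·x = 1` then `v(x) = 1`. [folklore] -/
theorem valuation_eq_one_of_map_mul_self (hσv : ∀ x, v (σ x) = v x) {x : K} (h : σ x * x = 1) : v x = 1 := by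
  have h2 : v x * v x = 1 := by
    have := congrArg v h
    rwa [Valuation.map_mul, hσv, Valuation.map_one] at this
  rcases lt_trichotomy (v x) 1 with hlt | heq | hgt
  · exfalso
    have hx0 : v x ≠ 0 := fun h0 => by rw [h0, mul_zero] at h2; exact zero_ne_one h2
    have : v x * v x < 1 := by
      calc v x * v x < v x * 1 := mul_lt_mul_of_pos_left hlt (zero_lt_iff.2 hx0)
        _ = v x := mul_one _
        _ < 1 := hlt
    rw [h2] at this; exact lt_irrefl _ this
  · exact heq
  · exfalso
    have : 1 < v x * v x := by
      calc (1 : Γ₀) < v x := hgt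
        _ = v x * 1 := (mul_one _).symm
        _ < v x * v x := mul_lt_mul_of_pos_left hgt (lt_trans zero_lt_one hgt)
    rw [h2] at this; exact lt_irrefl _ this

/-- A SCALAR element `β·1` of `U(σ, J)` (`J` with a non-zero entry) has `σ(β)·β = 1`. [folklore] -/
theorem map_mul_self_eq_one_of_scalar_mem {n : Type*} [Fintype n] [DecidableEq n] {J : Matrix n n K} {i j : n} (hJ : J i j ≠ 0)
    {g : GL n K} (hg : g ∈ unitaryGroupOfForm σ J) {β : K} (hβ : (g : Matrix n n K) = β • (1 : Matrix n n K)) : σ β * β = 1 := by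
  rw [mem_unitaryGroupOfForm_iff, hβ] at hg
  have h1 : ((β • (1 : Matrix n n K)).map σ)ᵀ * J * (β • (1 : Matrix n n K)) = (σ β * β) • J := by
    rw [Matrix.smul_one_eq_diagonal, diagonal_map (map_zero σ), diagonal_transpose, ← Matrix.smul_one_eq_diagonal, ← Matrix.smul_one_eq_diagonal]
    simp only [smul_mul_assoc, one_mul, mul_smul_comm, mul_one, smul_smul]
    rw [mul_comm]
  rw [h1] at hg
  have h2 := congrFun (congrFun hg i) j
  rw [Matrix.smul_apply, smul_eq_mul] at h2
  have : (σ β * β - 1) * J i j = 0 := by rw [sub_mul, one_mul, h2, sub_self]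
  rcases mul_eq_zero.1 this with h0 | h0
  · exact sub_eq_zero.1 h0
  · exact absurd h0 hJ

/-- The entry of a `1 × 1` element of `U(σ, J)` (`J₀₀ ≠ 0`) has `σ(u)·u = 1`. [folklore] -/
theorem map_mul_self_eq_one_of_mem_fin_one {J : Matrix (Fin 1) (Fin 1) K} (hJ : J 0 0 ≠ 0) {g : GL (Fin 1) K} (hg : g ∈ unitaryGroupOfForm σ J) :
    σ ((g : Matrix (Fin 1) (Fin 1) K) 0 0) * (g : Matrix (Fin 1) (Fin 1) K) 0 0 = 1 := by
  refine map_mul_self_eq_one_of_scalar_mem σ hJ hg ?_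
  ext i j
  fin_cases i; fin_cases j
  simp

end Scalar

/-! ## §2 The coefficients of `p · (X − u)` for a monic quadratic `p` -/

section Poly

variable {R : Type*} [CommRing R]

/-- For `p = X² + p₁ X + p₀` (i.e. `natDegree p = 2`, monic): `coeff₂ (p·(X − u)) = p₁ − u`… in the form used below: with `p = charpoly M` of a `2 × 2` matrix `M`
(`= X² − tr M · X + det M`, Mathlib `charpoly_fin_two`): `(p·(X − C u)).coeff 2 = −(tr M + u)` and `(p·(X − C u)).coeff 0 = −(det M · u)`. [folklore] -/
theorem coeff_charpoly_two_mul_X_sub_C [Nontrivial R] (M : Matrix (Fin 2) (Fin 2) R) (u : R) :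
    (M.charpoly * (X - C u)).coeff 2 = -(M.trace + u) ∧ (M.charpoly * (X - C u)).coeff 0 = -(M.det * u) := by
  have h : M.charpoly * (X - C u) = X ^ 3 - C (M.trace + u) * X ^ 2 + C (M.det + M.trace * u) * X - C (M.det * u) := by
    rw [Matrix.charpoly_fin_two]
    simp only [map_add, map_mul]
    ring
  rw [h]
  simp only [coeff_sub, coeff_add, coeff_C_mul, coeff_X_pow, coeff_X, coeff_C]
  norm_num

end Poly

/-! ## §3 The G-side off-stratum test on the CM carriers -/

section CM

variable (L : Type) [Field L] [NumberField L] [IsCMField L] (v : HeightOneSpectrum (𝓞 ↥(maximalRealSubfield L)))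
  (w : PlacesOver L v) (hw : IsCMField.complexConj L • w.1 = w.1)

set_option maxHeartbeats 1600000 in  -- statement-level `whnf` on the CM carriers (same budget class as ★ `charpoly_conj_out_eq_of_delta_ne_zero`'s consumers)
/-- **D3-iii-G «OFF-STRATUM TEST, G-SIDE».**  Notation: `G = U(Φ₃)(L⁺_v)` (★ `cmDatum L 3 Φ₃`), `E₃ = localNonsplitEquiv` at `(w, hw)`, `σ_w = galAdicCompletionMap`.
Data: a compact-open subgroup `Kn ≤ G` of LEVEL `r < 1` under `E₃`; `z, a ∈ G` with `E₃ z = β·1` (central `z`, ★ `forall_mem_center_cmLocal_eq_scalar`) and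
`E₃ a = diag(α, 1, (σ_w α)⁻¹)` (the ray of «XIG»), `0 < |α|_w < 1`, `m ≥ 1`; a transfer factor `T` (e.g. Δ‴); `γ_H ∈ H_v`; a class `c` with `T.Δ γ_H (out c) ≠ 0`
having a conjugate `y·out c·y⁻¹` in the shell `Kn (z aᵐ) Kn`.  Then the `U(Φ₂)`-block `h₂ = γ_H.1`, read at `w`, satisfies `|det h₂|_w < |tr h₂|_w²` — the hypothesis
of ★ HYP `exists_mem_unitaryGroup_eigenframe_of_valued_det_lt`. [cite: Rogawski1990, §4.3 p. 42; §12.7 L. 12.7.3 (proof) p. 195] -/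
theorem valued_det_lt_trace_sq_of_delta_ne_zero_of_conj_mem_shell
    (Kn : Subgroup ((cmDatum L 3 (qsForm L)).Local v)) {r : WithZero (Multiplicative ℤ)} (hr : r < 1)
    (hK : ∀ k ∈ Kn, ∀ i j, Valued.v ((((localNonsplitEquiv (IsCMField.complexConj L) (qsForm L) (IsCMField.complexConj_ne_one L) w hw k :
        ↥(unitaryGroupOfForm (galAdicCompletionMap (L := L) (IsCMField.complexConj L) hw) (placeForm (qsForm L) w.1))) :
        GL (Fin 3) (w.1.adicCompletion L)) : Matrix (Fin 3) (Fin 3) (w.1.adicCompletion L)) i j - (1 : Matrix (Fin 3) (Fin 3) (w.1.adicCompletion L)) i j) ≤ r)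
    {z a : (cmDatum L 3 (qsForm L)).Local v} {β α : w.1.adicCompletion L}
    (hz : (((localNonsplitEquiv (IsCMField.complexConj L) (qsForm L) (IsCMField.complexConj_ne_one L) w hw z :
        ↥(unitaryGroupOfForm (galAdicCompletionMap (L := L) (IsCMField.complexConj L) hw) (placeForm (qsForm L) w.1))) :
        GL (Fin 3) (w.1.adicCompletion L)) : Matrix (Fin 3) (Fin 3) (w.1.adicCompletion L)) = β • (1 : Matrix (Fin 3) (Fin 3) (w.1.adicCompletion L)))
    (hβ : Valued.v β = 1)
    (ha : (((localNonsplitEquiv (IsCMField.complexConj L) (qsForm L) (IsCMField.complexConj_ne_one L) w hw a :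
        ↥(unitaryGroupOfForm (galAdicCompletionMap (L := L) (IsCMField.complexConj L) hw) (placeForm (qsForm L) w.1))) :
        GL (Fin 3) (w.1.adicCompletion L)) : Matrix (Fin 3) (Fin 3) (w.1.adicCompletion L)) =
        Matrix.diagonal ![α, 1, ((galAdicCompletionMap (L := L) (IsCMField.complexConj L) hw) α)⁻¹])
    (hα0 : α ≠ 0) (hα1 : Valued.v α < 1) {m : ℕ} (hm : 1 ≤ m)
    [∀ γ : (cmDatum L 3 (qsForm L)).Local v, MeasurableSpace ((cmDatum L 3 (qsForm L)).Local v ⧸ Subgroup.centralizer ({γ} : Set ((cmDatum L 3 (qsForm L)).Local v)))]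
    [∀ aH : ((cmDatum L 2 (Matrix.of fun i j : Fin 2 => if i.val + j.val + 1 = 2 then (1 : L) else 0)).Local v ×
        (cmDatum L 1 (Matrix.of fun i j : Fin 1 => if i.val + j.val + 1 = 1 then (1 : L) else 0)).Local v),
      MeasurableSpace (((cmDatum L 2 (Matrix.of fun i j : Fin 2 => if i.val + j.val + 1 = 2 then (1 : L) else 0)).Local v ×
          (cmDatum L 1 (Matrix.of fun i j : Fin 1 => if i.val + j.val + 1 = 1 then (1 : L) else 0)).Local v) ⧸
        Subgroup.centralizer ({aH} : Set ((cmDatum L 2 (Matrix.of fun i j : Fin 2 => if i.val + j.val + 1 = 2 then (1 : L) else 0)).Local v ×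
          (cmDatum L 1 (Matrix.of fun i j : Fin 1 => if i.val + j.val + 1 = 1 then (1 : L) else 0)).Local v)))]
    (T : LocalTransferFactor L (qsForm L) v)
    (γH : (cmDatum L 2 (Matrix.of fun i j : Fin 2 => if i.val + j.val + 1 = 2 then (1 : L) else 0)).Local v ×
      (cmDatum L 1 (Matrix.of fun i j : Fin 1 => if i.val + j.val + 1 = 1 then (1 : L) else 0)).Local v)
    (c : ConjClasses ((cmDatum L 3 (qsForm L)).Local v)) (hΔ : T.Δ γH (Quotient.out c) ≠ 0)
    (y : (cmDatum L 3 (qsForm L)).Local v) (hy : y * Quotient.out c * y⁻¹ ∈ DoubleCoset.doubleCoset (z * a ^ m) (Kn : Set ((cmDatum L 3 (qsForm L)).Local v)) Kn) :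
    Valued.v ((Pi.evalRingHom (fun w' : PlacesOver L v => w'.1.adicCompletion L) w) ((γH.1.val : GL (Fin 2) (LocalRing L v)) : Matrix (Fin 2) (Fin 2) (LocalRing L v)).det) <
      Valued.v ((Pi.evalRingHom (fun w' : PlacesOver L v => w'.1.adicCompletion L) w) ((γH.1.val : GL (Fin 2) (LocalRing L v)) : Matrix (Fin 2) (Fin 2) (LocalRing L v)).trace) ^ 2 := by
  -- abbreviations
  set ev := Pi.evalRingHom (fun w' : PlacesOver L v => w'.1.adicCompletion L) w with hev
  set σw := galAdicCompletionMap (L := L) (IsCMField.complexConj L) hw with hσw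
  -- the hom `E₃ : G →* GL₃(L_w)`
  set E : (cmDatum L 3 (qsForm L)).Local v →* GL (Fin 3) (w.1.adicCompletion L) :=
    (unitaryGroupOfForm σw (placeForm (qsForm L) w.1)).subtype.comp
      (localNonsplitEquiv (IsCMField.complexConj L) (qsForm L) (IsCMField.complexConj_ne_one L) w hw).toMonoidHom with hE
  have hEapply : ∀ g, ((E g : GL (Fin 3) (w.1.adicCompletion L)) : Matrix (Fin 3) (Fin 3) (w.1.adicCompletion L)) =
      (((localNonsplitEquiv (IsCMField.complexConj L) (qsForm L) (IsCMField.complexConj_ne_one L) w hw g :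
        ↥(unitaryGroupOfForm σw (placeForm (qsForm L) w.1))) : GL (Fin 3) (w.1.adicCompletion L)) : Matrix (Fin 3) (Fin 3) (w.1.adicCompletion L)) :=
    fun g => rfl
  -- (1) the shell pattern of the conjugate, via D3-iii-hom
  have hσv : ∀ x, Valued.v (σw x) = Valued.v x := fun x => valued_galAdicCompletionMap (L := L) (IsCMField.complexConj L) hw x
  have hvα0 : Valued.v α ≠ 0 := (Valuation.ne_zero_iff _).2 hα0
  have hαα' : Valued.v α * Valued.v (σw α)⁻¹ = 1 := by
    rw [Valuation.map_inv, hσv, mul_inv_cancel₀ hvα0]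
  have hK' : ∀ k ∈ Kn, ∀ i j, Valued.v (((E k : GL (Fin 3) (w.1.adicCompletion L)) : Matrix (Fin 3) (Fin 3) (w.1.adicCompletion L)) i j -
      (1 : Matrix (Fin 3) (Fin 3) (w.1.adicCompletion L)) i j) ≤ r := fun k hk i j => by rw [hEapply]; exact hK k hk i j
  have hz' : ((E z : GL (Fin 3) (w.1.adicCompletion L)) : Matrix (Fin 3) (Fin 3) (w.1.adicCompletion L)) = β • (1 : Matrix (Fin 3) (Fin 3) (w.1.adicCompletion L)) := by
    rw [hEapply]; exact hz
  have ha' : ((E a : GL (Fin 3) (w.1.adicCompletion L)) : Matrix (Fin 3) (Fin 3) (w.1.adicCompletion L)) = diagonal ![α, 1, (σw α)⁻¹] := by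
    rw [hEapply]; exact ha
  obtain ⟨h2, -, h0⟩ := F0P3cStCharTSShellPatternHom.valuation_charpoly_coeff_of_mem_shell Valued.v E Kn hr hK' hz' ha'
    (by rw [hβ]; exact one_ne_zero) hvα0 hα1 (Valuation.map_one _) hαα' hm hy
  rw [hβ, one_mul] at h2
  rw [hβ, one_mul, mul_one, one_mul, ← mul_pow, hαα', one_pow] at h0
  -- (2) the characteristic polynomial of the matched class = `χ_{h₂}·(X − u)` read at `w`
  have hchar := charpoly_conj_out_eq_of_delta_ne_zero L (qsForm L) v w hw T γH c hΔ y
  rw [← hEapply] at hchar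
  rw [Matrix.charpoly_map, charpoly_endoEmbLocal, Polynomial.map_mul, Polynomial.map_sub, Polynomial.map_X, Polynomial.map_C] at hchar
  -- `(finCharpolyTwo γH).map ev = charpoly (h₂.map ev)`
  have hfin : (finCharpolyTwo L v γH).map ev = (((γH.1.val : GL (Fin 2) (LocalRing L v)) : Matrix (Fin 2) (Fin 2) (LocalRing L v)).map ev).charpoly := by
    unfold finCharpolyTwo
    rw [Matrix.charpoly_map]
  rw [hfin] at hchar
  set M₂ : Matrix (Fin 2) (Fin 2) (w.1.adicCompletion L) := (((γH.1.val : GL (Fin 2) (LocalRing L v)) : Matrix (Fin 2) (Fin 2) (LocalRing L v)).map ev) with hM₂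
  set u : w.1.adicCompletion L := ev (finGammaTwo L v γH) with hu
  obtain ⟨hc2, hc0⟩ := coeff_charpoly_two_mul_X_sub_C M₂ u
  rw [hchar, hc2, Valuation.map_neg] at h2
  rw [hchar, hc0, Valuation.map_neg] at h0
  -- (3) `|u|_w = 1` (the `U(Φ₁)`-component is unitary) and the cubic-pattern lemma
  have huv : Valued.v u = 1 := by
    -- `u = (E₁ γH.2)₀₀`, `E₁` the one-place model of `U(Φ₁)`; unitary `1 × 1` ⇒ `σ(u) u = 1`
    have hmem := (localNonsplitEquiv (IsCMField.complexConj L) (Matrix.of fun i j : Fin 1 => if i.val + j.val + 1 = 1 then (1 : L) else 0)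
      (IsCMField.complexConj_ne_one L) w hw γH.2).2
    have hcoe := coe_localNonsplitEquiv_eq_map L v w hw (N := 1) (H := Matrix.of fun i j : Fin 1 => if i.val + j.val + 1 = 1 then (1 : L) else 0) γH.2
    have hJ : (placeForm (Matrix.of fun i j : Fin 1 => if i.val + j.val + 1 = 1 then (1 : L) else 0) w.1) 0 0 ≠ 0 := by
      simp [placeForm, Matrix.map_apply]
    have h1 := map_mul_self_eq_one_of_mem_fin_one σw hJ hmem
    rw [hcoe, Matrix.map_apply] at h1
    have : u = ev ((γH.2.val.val : Matrix (Fin 1) (Fin 1) (LocalRing L v)) 0 0) := by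
      rw [hu]; unfold finGammaTwo; rfl
    rw [this]
    exact valuation_eq_one_of_map_mul_self Valued.v σw hσv h1
  have hA : (1 : WithZero (Multiplicative ℤ)) < Valued.v (σw α)⁻¹ ^ m := by
    have hα'gt : 1 < Valued.v (σw α)⁻¹ := by
      rw [Valuation.map_inv, hσv]
      exact one_lt_inv_iff₀.2 ⟨zero_lt_iff.2 hvα0, hα1⟩
    exact one_lt_pow₀ hα'gt (by omega)
  have htrace : M₂.trace = ev ((γH.1.val : GL (Fin 2) (LocalRing L v)) : Matrix (Fin 2) (Fin 2) (LocalRing L v)).trace := by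
    rw [hM₂, Matrix.trace, Matrix.trace, map_sum]; rfl
  have hdet : M₂.det = ev ((γH.1.val : GL (Fin 2) (LocalRing L v)) : Matrix (Fin 2) (Fin 2) (LocalRing L v)).det := by
    rw [hM₂, ← RingHom.mapMatrix_apply, ← RingHom.map_det]
  rw [← htrace, ← hdet]
  exact F0P3cStCharTSOffStratumVal.valued_lt_sq_of_cubic_pattern Valued.v huv h2 hA h0 hA.le

end CM

end Summit.HodgeConjecture.HodgeConjecture.Cruxes.H413.F0P3cStCharTSOffStratumG
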